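import Summits.CriticalPhenomena.PercolationContinuityZ3.Theorems.PercNearOneGluingNoHeavyLowerTailSunflowerTypeModel
import HarnessLib

/-!
# `NoHeavyLowerTail` (crux stmt-CriticalPhenomena-4575), abstract sunflower cubic: TYPE MODEL, part 3 — the canonical plan, the map
# `Ψ`, preservation of multiplicities, and `Ψ(BAD) ⊆ GOOD`

Support file (seat `prim-ineq-prove-1` gen 40; `--supports stmt-CriticalPhenomena-4575`).  No `sorry`, no named facts.  Memo:
run/shared/lean/prim/prim-ineq-prove-1/FINDING-BIPARTITE-prove1-g40.md (§3 the type model, §4 the injection Ψ).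

THE PROGRAMME.  THEOREM (memo): every BIPARTITE graph core `edgeCore Γ` is A-safe (Lemma A for every number of petals and every
product measure).  Polarisation + symmetrisation + conditioning on one side of the bipartition reduce it to the purely finite
TYPE-MODEL LEMMA `TypeModel.Model.typeModel_lemma` (file `…SunflowerTypeModelLemma`): for K slots, elements with killer types
`τ x ⊆ [K]` and multiplicities, petal labels and an orientation digraph `O`, one has, for every multiplicity profile,
`Σ_{BAD S} (K − |nonA S|)! ≤ (K−1)!·#GOOD`.  The proof is an explicit injection `(S, enumeration) ↦ (Ψ S, key)`: rotate the contents
of the non-A slots along a Hamiltonian path of `O|_N` whose start dominates its end (else its last-but-one), strip the new Z-slot,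
and encode the path reversed in front of the enumeration.

THIS FILE (part 3).  `nonempty_plan_of_bad` (part 1's Lemma 4.2 + Rédei on the non-A slots), `canon N` (a type-I plan if one
exists, else any plan; depends on `N` only), `psiWith P S` (rotate every slot set along `ρ`; move the `F_z`-elements that came from
slot `u` out of `z` into `pen`; type II: the `F_pen`-elements into `pen2`), `psi`; `card_psi` (multiplicities preserved), the origin
facts `of_z_mem_psiWith`, `mem_psiWith_of_mem_map`, and `good_psi`: **`Ψ` of a BAD configuration is GOOD**, its unique non-A slot
being the end `z` of the canonical path (`not_isA_psiWith_z`, `not_isP_psiWith_z`, `isA_psiWith_of_ne_z`).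
-/

namespace Summit.CriticalPhenomena.PercolationContinuityZ3.Theorems.SunflowerPartition

namespace TypeModel

open Finset Literature.Combinatorics.Digraph

variable {K : ℕ} {ι : Type*} {Λ : Type*}

namespace Model

variable {M : Model K ι Λ} {S : ι → Finset (Fin K)}

/-! ### Existence of plans, the canonical plan, the map `Ψ` -/

/-- A BAD configuration admits a plan for its non-A set (Lemma 4.2 + Rédei). [this work] -/
theorem nonempty_plan_of_bad (hS : M.Bad S) : Nonempty (M.Plan (M.nonA S)) := by
  classical
  obtain ⟨u, w, mid, h⟩ := exists_isHamPath_bypass_or_penultimate (M.semicomplete_of_bad S hS) hS.1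
  rcases h with ⟨hham, huw⟩ | ⟨v, hham, huw⟩
  · exact ⟨{ u := u, mid := mid, w := w, v := none, ham := by simpa using hham, dom := huw }⟩
  · exact ⟨{ u := u, mid := mid, w := w, v := some v, ham := by simpa using hham, dom := huw }⟩

/-- The CANONICAL plan of a slot set: a type-I plan if one exists, else any plan (type II), else none.
It depends only on `N` (and `M`) — this is what makes decoding possible. [this work] -/
noncomputable def canon (N : Finset (Fin K)) : Option (M.Plan N) := by
  classical
  exact if h : Nonempty {P : M.Plan N // P.v = none} then some (Classical.choice h).1
    else if h' : Nonempty (M.Plan N) then some (Classical.choice h') else none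

/-- A BAD configuration has a canonical plan. [this work] -/
theorem canon_isSome_of_bad (hS : M.Bad S) : ∃ P, M.canon (M.nonA S) = some P := by
  classical
  unfold canon
  split_ifs with h h'
  · exact ⟨_, rfl⟩
  · exact ⟨_, rfl⟩
  · exact absurd (nonempty_plan_of_bad hS) h'

/-- The map `Ψ` for a given plan: rotate the slot sets along the path (`ρ`), then move the `F_z`-elements that came
from slot `u` out of `z` into `pen`, and (type II) the `F_pen`-elements into `pen2`. [this work] -/
noncomputable def psiWith {N : Finset (Fin K)} (P : M.Plan N) (S : ι → Finset (Fin K)) : ι → Finset (Fin K) :=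
  fun x =>
    let S₁ := (S x).map P.rho.toEmbedding
    if P.u ∈ S x then
      if P.z ∈ M.τ x then insert P.pen (S₁.erase P.z)
      else if P.v.isSome ∧ P.pen ∈ M.τ x then insert P.pen2 (S₁.erase P.z)
      else S₁
    else S₁

/-- **The map `Ψ`** on configurations (identity when there is no canonical plan). [this work] -/
noncomputable def psi (S : ι → Finset (Fin K)) : ι → Finset (Fin K) :=
  match M.canon (M.nonA S) with
  | none => S
  | some P => M.psiWith P S

section PsiWith

variable {N : Finset (Fin K)} (P : M.Plan N)

/-- Membership in a rotated slot set. [this work] -/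
theorem mem_map_rho {x : ι} {k : Fin K} : k ∈ (S x).map P.rho.toEmbedding ↔ P.rho.symm k ∈ S x := by
  rw [Finset.mem_map_equiv]

/-- After the rotation, `z ∈ S₁ x ↔ u ∈ S x`. -/
theorem z_mem_map_rho_iff {x : ι} : P.z ∈ (S x).map P.rho.toEmbedding ↔ P.u ∈ S x := by
  rw [mem_map_rho]
  have : P.rho.symm P.z = P.u := by rw [Equiv.symm_apply_eq]; exact P.rho_u.symm
  rw [this]

/-- After the rotation, `pen ∈ S₁ x ↔ z ∈ S x`. -/
theorem pen_mem_map_rho_iff {x : ι} : P.pen ∈ (S x).map P.rho.toEmbedding ↔ P.z ∈ S x := by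
  rw [mem_map_rho]
  have : P.rho.symm P.pen = P.z := by rw [Equiv.symm_apply_eq]; exact P.rho_z.symm
  rw [this]

/-- After the rotation (type II), `pen2 ∈ S₁ x ↔ pen ∈ S x`. -/
theorem pen2_mem_map_rho_iff {x : ι} {v : Fin K} (hv : P.v = some v) :
    P.pen2 ∈ (S x).map P.rho.toEmbedding ↔ P.pen ∈ S x := by
  rw [mem_map_rho]
  have : P.rho.symm P.pen2 = P.pen := by rw [Equiv.symm_apply_eq]; exact (P.rho_pen_of_typeII hv).symm
  rw [this]

/-- A slot `k ≠ z` that is in `Ψ`'s rotated set stays in the final set (dumps only remove `z`). -/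
theorem mem_psiWith_of_mem_map {x : ι} {k : Fin K} (hkz : k ≠ P.z) (hk : k ∈ (S x).map P.rho.toEmbedding) :
    k ∈ M.psiWith P S x := by
  classical
  unfold psiWith; simp only
  split_ifs
  · exact Finset.mem_insert_of_mem (Finset.mem_erase.2 ⟨hkz, hk⟩)
  · exact Finset.mem_insert_of_mem (Finset.mem_erase.2 ⟨hkz, hk⟩)
  · exact hk
  · exact hk

/-- If `z` is in the final set of `x`, then `u ∈ S x`, `x ∉ F_z`, and (type II) `x ∉ F_pen`. -/
theorem of_z_mem_psiWith {x : ι} (hzx : P.z ∈ M.psiWith P S x) :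
    P.u ∈ S x ∧ P.z ∉ M.τ x ∧ (P.v.isSome → P.pen ∉ M.τ x) := by
  classical
  unfold psiWith at hzx; simp only at hzx
  split_ifs at hzx with hu hzt hpt
  · rw [Finset.mem_insert, Finset.mem_erase] at hzx
    rcases hzx with h | ⟨h, -⟩
    · exact absurd h.symm P.pen_ne_z
    · exact absurd rfl h
  · obtain ⟨v, hv⟩ := Option.isSome_iff_exists.1 hpt.1
    rw [Finset.mem_insert, Finset.mem_erase] at hzx
    rcases hzx with h | ⟨h, -⟩
    · exact absurd h.symm (P.pen2_ne_z_of_typeII hv)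
    · exact absurd rfl h
  · exact ⟨hu, hzt, fun hs => fun hp => hpt ⟨hs, hp⟩⟩
  · exact absurd ((z_mem_map_rho_iff P).1 hzx) hu

/-- In `Ψ S` the slot `z` is not an A-slot. [this work] -/
theorem not_isA_psiWith_z : ¬ M.IsA (M.psiWith P S) P.z := by
  rintro ⟨x, hzx, hzt⟩
  exact (of_z_mem_psiWith P hzx).2.1 hzt

variable (hN : N = M.nonA S)
include hN

/-- `Ψ` preserves the number of slots of every element. [this work] -/
theorem card_psiWith (x : ι) : (M.psiWith P S x).card = (S x).card := by
  classical
  have hz : ¬ M.IsA S P.z := (M.mem_nonA S).1 (hN ▸ P.z_mem)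
  have hpen : ¬ M.IsA S P.pen := (M.mem_nonA S).1 (hN ▸ P.pen_mem)
  unfold psiWith
  simp only
  split_ifs with hu hzx hpx
  · -- dump into pen
    have hzin : P.z ∈ (S x).map P.rho.toEmbedding := (z_mem_map_rho_iff P).2 hu
    have hpnot : P.pen ∉ ((S x).map P.rho.toEmbedding).erase P.z := by
      rw [Finset.mem_erase, pen_mem_map_rho_iff]
      rintro ⟨-, hzS⟩; exact hz ⟨x, hzS, hzx⟩
    rw [Finset.card_insert_of_notMem hpnot, Finset.card_erase_of_mem hzin, Finset.card_map]
    have : 0 < (S x).card := Finset.card_pos.2 ⟨_, hu⟩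
    omega
  · -- dump into pen2 (type II)
    obtain ⟨v, hv⟩ := Option.isSome_iff_exists.1 hpx.1
    have hzin : P.z ∈ (S x).map P.rho.toEmbedding := (z_mem_map_rho_iff P).2 hu
    have hqnot : P.pen2 ∉ ((S x).map P.rho.toEmbedding).erase P.z := by
      rw [Finset.mem_erase, pen2_mem_map_rho_iff P hv]
      rintro ⟨-, hpS⟩; exact hpen ⟨x, hpS, hpx.2⟩
    rw [Finset.card_insert_of_notMem hqnot, Finset.card_erase_of_mem hzin, Finset.card_map]
    have : 0 < (S x).card := Finset.card_pos.2 ⟨_, hu⟩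
    omega
  · rw [Finset.card_map]
  · rw [Finset.card_map]

/-- In `Ψ S` the slot `z` is not a P-slot. [this work] -/
theorem not_isP_psiWith_z : ¬ M.IsP (M.psiWith P S) P.z := by
  rintro ⟨-, -, hwit⟩
  have hu : ¬ M.IsA S P.u := (M.mem_nonA S).1 (hN ▸ P.u_mem)
  rcases hv : P.v with _ | v
  · -- type I: `u ∈ In(z)`, but an `F_u`-element in slot `z` of `Ψ S` would have been in slot `u` of `S`
    obtain ⟨x, hzx, hut⟩ := hwit P.u (P.O_u_z_of_typeI hv)
    exact hu ⟨x, (of_z_mem_psiWith P hzx).1, hut⟩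
  · -- type II: `pen ∈ In(z)`, but all `F_pen`-elements were moved out of `z`
    obtain ⟨x, hzx, hpt⟩ := hwit P.pen P.O_pen_z
    exact (of_z_mem_psiWith P hzx).2.2 (by simp [hv]) hpt

/-- In `Ψ S` every slot other than `z` is an A-slot. [this work] -/
theorem isA_psiWith_of_ne_z (hS : M.Bad S) {k : Fin K} (hkz : k ≠ P.z) : M.IsA (M.psiWith P S) k := by
  classical
  by_cases hk : k ∈ N
  · -- a path vertex: its successor `k'` was a P-slot holding an `F_k`-witness, which `ρ` moves into `k`
    obtain ⟨k', hk'N, hρ, hOkk'⟩ := P.exists_succ hk hkz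
    have hPk' : M.IsP S k' := hS.2.1 k' (hN ▸ hk'N)
    obtain ⟨x, hk'x, hkt⟩ := hPk'.2.2 k hOkk'
    refine ⟨x, mem_psiWith_of_mem_map P hkz ?_, hkt⟩
    rw [mem_map_rho, (Equiv.symm_apply_eq P.rho).2 hρ.symm]; exact hk'x
  · -- an old A-slot: untouched
    have hA : M.IsA S k := by
      by_contra h; exact hk (hN ▸ (M.mem_nonA S).2 h)
    obtain ⟨x, hkx, hkt⟩ := hA
    refine ⟨x, mem_psiWith_of_mem_map P hkz ?_, hkt⟩
    rw [mem_map_rho, (Equiv.symm_apply_eq P.rho).2 (P.rho_of_notMem hk).symm]; exact hkx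

/-- `Ψ S` is GOOD, with Z-slot `z`. [this work] -/
theorem good_psiWith (hS : M.Bad S) : M.nonA (M.psiWith P S) = {P.z} ∧ ¬ M.IsP (M.psiWith P S) P.z := by
  classical
  refine ⟨?_, not_isP_psiWith_z P hN⟩
  ext k
  rw [mem_nonA, Finset.mem_singleton]
  refine ⟨fun h => ?_, fun h => h ▸ not_isA_psiWith_z P⟩
  by_contra hkz; exact h (isA_psiWith_of_ne_z P hN hS hkz)

end PsiWith

/-- **`Ψ` of a BAD configuration is GOOD** (and the Z-slot is the end of the canonical path). [this work] -/
theorem good_psi (hS : M.Bad S) : M.Good (M.psi S) := by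
  obtain ⟨P, hP⟩ := canon_isSome_of_bad hS
  unfold psi; rw [hP]
  exact ⟨P.z, good_psiWith P rfl hS⟩

/-- **`Ψ` preserves multiplicities.** [this work] -/
theorem card_psi (hS : M.Bad S) (x : ι) : (M.psi S x).card = (S x).card := by
  obtain ⟨P, hP⟩ := canon_isSome_of_bad hS
  unfold psi; rw [hP]
  exact card_psiWith P rfl x


end Model

end TypeModel

end Summit.CriticalPhenomena.PercolationContinuityZ3.Theorems.SunflowerPartition
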